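import Literature.AnabelianGeometry.EtaleTheta.Discharge.Sec5Thm57AnchoredFamily
import Literature.AnabelianGeometry.EtaleTheta.BiKummerRootRebase
import Literature.AnabelianGeometry.EtaleTheta.Discharge.Sec4RootTwistLaws

/-!
# [EtTh] §5, Theorem 5.7 final knit, FILE 2: the COHERENT FAMILY `hfam` of the anchored capstone at the genuine connected tower, from Prop. 4.2 (iv) at the rebased roots (pp. 318–319, 329–330 / PDF pp. 92–93, 103–104)

Mochizuki, *The étale theta function …*, Publ. RIMS **45** (2009) [cite: MochizukiEtTh2009, Thm 5.7 p.329–330 (PDF pp.103–104);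
Rmk 4.3.2 p.318–319 (PDF pp.92–93); Prop 4.2 (iv) p.315 (PDF p.89)].  abc-iut cell, layer L2, row R219 FINAL KNIT — FILE 2 PROPER
(seat abc-iut-w5-d245 gen 4, by the split with abc-iut-f-121 gen 2, STATUS 11:42–12:03Z; design abc-iut-L2-d4 gen 5, 11:23:35Z).
PROOF-ONLY (0 definitions, no new named fact).

WHAT.  abc-iut-L2-d4's anchored capstone `ThetaFrobenioidTower.thetaRootPreservedAll_ofConnectedTemperoidYddFamily_ofAnchored_ofPulledConstants`
(`Sec5Thm57AnchoredFamily.lean`, p442166) carries the binder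
`hfam : ∀ normalised anchor (α₁, β₁, u₁) at the first root, ∀ N, ∃ (a, b, w)` — identifications `a : Ψ(A_N) ⥲ A_N`, `b : Ψ(B_N) ⥲ B_N`
and a unit `w ∈ O^×(B_N)` transporting `s^⊓_N` on the nose and `s^⊔_N` up to `w`, COHERENT with the anchor along the transitions
`α_{1,N}`, `β_{1,N}` ("by allowing `N` to vary, we obtain a compatible system of roots", Rmk. 4.3.2).  This file PRODUCES `hfam` VERBATIM
(`hfam_ofConnectedTemperoidFamily_of_rebase`) at the genuine tower `T = ofConnectedTemperoidFamily …` from abc-iut-f-121's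
"p438241 at the rebased root" `BiKummerSetting.NthRoot.exists_coherent_family_member_rebase` (`BiKummerRootRebase.lean`, p443132: Prop. 4.2 (iv)
at the `u₁`-TWISTED level-1 pair applied to the level-`N` root REBASED over the level-1 pair, `NthRoot.rebase`), discharging on the way:
the two commutative squares, "isometries of Frobenius degree `N`" and the anchor-free data of the rebase (the tower's own
`comm_sCap/comm_sCup/isIsometry_α/β/degFr_α/β`), the disjoint-support clauses `hdisj`/`hdisjN` (abc-iut-f-121's `disjointSupports_twistUnit`,
`Φ` divisorial), the choice `f′ := fracOf (s^⊓_1, u₁ ∘ s^⊔_1)` / `f′_N := fracOf (s^⊓_N, ũ ∘ s^⊔_N)` (`hfrac := rfl`), and "isomorphisms are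
isometries" for the anchor (`PreFrobenioid.isIsometry_of_isIso`, [FrdI] Rem. 1.1.1 at the model).
RESIDUAL (explicit binders, each a NAMED input of abc-iut-f-121's theorem, quantified over the anchors / levels at which the capstone
consumes them): the Thm. 4.4 data of the self-equivalence (`h44 : Thm44Hyp`, `ψ`, `hpull`, `hii`, `h3`, `h4b`, `h8`, `h15a`, `h15`, `hpull₂`);
per level the Def. 4.1 (iv) datum of the transition and its pull-back compatibility (`D N`, `hD N` — (B1)/(B1′) of `NthRoot.rebase`); per
anchor the birational compatibility `hf` (Thm. 4.4 (ii) at `A_1`); per anchor and level the pointwise clause (e) `hArises`, the base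
isomorphism `hebs` (θ-shadow / Prop. 2.4), abc-iut-L2-d4's `hroot₁N` WITH its birational clauses (a unit `ũ ∈ O^×(B_N)` over `u₁` along
`β_{1,N}`, the power law `f′_N^N = (D_N.α₁)^* f′` and the saturation — Lem. 5.8 / Def. 4.1 (iii); abc-iut-f-123's R231 producers), and
Prop. 4.2 (iv) at the twisted level-1 pair (`hivP'`, ⇐ `Prop42_iv`/`ZetaA` L06).
HONEST FRAMING: kernel-checked implication for data so parametrised (the class `TemperedFrobenioid T₀ (ConnectedPart (BTemp X.Pi)) VD` is
not shown inhabited here); nothing asserts any result of [EtTh] unconditionally; typed ≠ discharged; no side taken on [IUTchIII] Cor. 3.12.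
-/

noncomputable section

namespace Literature.AnabelianGeometry.EtaleTheta

open CategoryTheory Opposite Literature.AlgebraicGeometry.Frobenioids Literature.AnabelianGeometry.SemiGraphs
  Literature.AnabelianGeometry.SemiGraphs.GaloisObjects

universe u₀ v₀ w

namespace ThetaFrobenioidTower

variable {K : Type u₀} [Field K] {X : SemiGraphs.TemperedArithmeticGroup.{u₀} K} {D₀ : Type u₀} [Category.{v₀} D₀]
  {V : FrdIMonoidStub.{w}} {T₀ : RealifiedDivisorMonoids (D₀ := D₀) V}
  {VD : FrdICatStub.{u₀ + 1, u₀, w} (ConnectedPart (BTemp X.Pi))}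
  {tf : TemperedFrobenioid T₀ (ConnectedPart (BTemp X.Pi)) VD} {hZ : tf.monoidType = MonoidType.Z}
  {hP : ∀ A : (ConnectedPart (BTemp X.Pi))ᵒᵖ, IsPerfect (tf.Φ.carrier A)}
  {NH : Subgroup (Field.absoluteGaloisGroup K) → tf.category → ℕ+ → Prop}
  {E : Set ℕ+} (𝒯 : ThetaEnvTower.{max u₀ w} E) (ιX : 𝒯.PiX ≃ₜ* X.Pi)
  {pullFrac : ∀ {A A' : (BiKummerSetting.mkOfConnectedTemperoidYddTower X tf hZ hP NH 𝒯 ιX).C} (_ : A' ⟶ A),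
    (BiKummerSetting.mkOfConnectedTemperoidYddTower X tf hZ hP NH 𝒯 ιX).biratUnits A →
      (BiKummerSetting.mkOfConnectedTemperoidYddTower X tf hZ hP NH 𝒯 ιX).biratUnits A'}
  {lv : ℕ+}
  {θ : (BiKummerSetting.mkOfConnectedTemperoidYddTower X tf hZ hP NH 𝒯 ιX).biratUnits
    (BiKummerSetting.mkOfConnectedTemperoidYddTower X tf hZ hP NH 𝒯 ιX).Aodot}
  {Bl : (BiKummerSetting.mkOfConnectedTemperoidYddTower X tf hZ hP NH 𝒯 ιX).C}
  {Pl : (BiKummerSetting.mkOfConnectedTemperoidYddTower X tf hZ hP NH 𝒯 ιX).FractionPair θ Bl}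
  {Rl : (BiKummerSetting.mkOfConnectedTemperoidYddTower X tf hZ hP NH 𝒯 ιX).NthRoot θ Pl lv pullFrac}
  (h : ModelFrobenioid.Hypotheses tf.divisorMonoid tf.ratFnFunctor)
  (Q : FrobenioidTheta.ThetaSubquotientStub.{w} (ConnectedPart (BTemp X.Pi))) (odd_l : Odd (lv : ℕ))
  (R : ∀ N : ℕ+, (BiKummerSetting.mkOfConnectedTemperoidYddTower X tf hZ hP NH 𝒯 ιX).NthRoot Rl.root Rl.pair N pullFrac)
  (K' : Type w) [Field K'] {X₀ : ConnectedPart (BTemp X.Pi)}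
  (t : ∀ N : ℕ+, (R N).BN.base ⟶ X₀)
  (c₀ : K'ˣ →* (tf.ratFnFunctor.obj (op X₀))ˣ)
  (hinj : ∀ N : ℕ+, Function.Injective ((Units.map (tf.ratFnFunctor.map (t N).op).hom).comp c₀))
  (hinvc : ∀ (N : ℕ+) (g : Aut (R N).AN.base),
    pull tf.divisorMonoid g.hom (ModelFrobenioid.div (R N).pair.num) = ModelFrobenioid.div (R N).pair.num)
  (hinvp : ∀ (N : ℕ+) (y : 𝒯.PiX), y ∈ 𝒯.PiYdd →
    pull tf.divisorMonoid ((BiKummerSetting.mkOfConnectedTemperoidYddTower X tf hZ hP NH 𝒯 ιX).galoisSurj (R N).AN.base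
      (R N).αData.isGalois (ιX y)).hom (ModelFrobenioid.div (R N).pair.den) = ModelFrobenioid.div (R N).pair.den)
  (α : ∀ {N N' : ℕ+}, (N : ℕ) ∣ N' → ((R N').AN ⟶ (R N).AN))
  (β : ∀ {N N' : ℕ+}, (N : ℕ) ∣ N' → ((R N').BN ⟶ (R N).BN))
  (comm_sCap : ∀ {N N' : ℕ+} (hd : (N : ℕ) ∣ N'), (R N').pair.num ≫ β hd = α hd ≫ (R N).pair.num)
  (comm_sCup : ∀ {N N' : ℕ+} (hd : (N : ℕ) ∣ N'), (R N').pair.den ≫ β hd = α hd ≫ (R N).pair.den)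
  (isIsometry_α : ∀ {N N' : ℕ+} (hd : (N : ℕ) ∣ N'),
    ((BiKummerSetting.mkOfConnectedTemperoidYddTower X tf hZ hP NH 𝒯 ιX).sec5Stub h).pre.IsIsometry (α hd))
  (degFr_α : ∀ {N N' : ℕ+} (hd : (N : ℕ) ∣ N'),
    (((BiKummerSetting.mkOfConnectedTemperoidYddTower X tf hZ hP NH 𝒯 ιX).sec5Stub h).pre.degFr (α hd) : ℕ) * N = N')
  (isIsometry_β : ∀ {N N' : ℕ+} (hd : (N : ℕ) ∣ N'),
    ((BiKummerSetting.mkOfConnectedTemperoidYddTower X tf hZ hP NH 𝒯 ιX).sec5Stub h).pre.IsIsometry (β hd))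
  (degFr_β : ∀ {N N' : ℕ+} (hd : (N : ℕ) ∣ N'),
    (((BiKummerSetting.mkOfConnectedTemperoidYddTower X tf hZ hP NH 𝒯 ιX).sec5Stub h).pre.degFr (β hd) : ℕ) * N = N')
  (baseFrob_α : ∀ {N N' : ℕ+} (hd : (N : ℕ) ∣ N'),
    (BiKummerSetting.mkOfConnectedTemperoidYddTower X tf hZ hP NH 𝒯 ιX).IsOfBaseFrobeniusType (α hd))
  -- the Thm. 4.4 data of the self-equivalence `Ψ = h44.Ψ`
  (h44 : BiKummerSetting.Thm44Hyp (BiKummerSetting.mkOfConnectedTemperoidYddTower X tf hZ hP NH 𝒯 ιX)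
    (BiKummerSetting.mkOfConnectedTemperoidYddTower X tf hZ hP NH 𝒯 ιX))
  (ψ : ∀ A : (BiKummerSetting.mkOfConnectedTemperoidYddTower X tf hZ hP NH 𝒯 ιX).C,
    (BiKummerSetting.mkOfConnectedTemperoidYddTower X tf hZ hP NH 𝒯 ιX).biratUnits A ≃*
      (BiKummerSetting.mkOfConnectedTemperoidYddTower X tf hZ hP NH 𝒯 ιX).biratUnits (h44.Ψ.functor.obj A))
  (hpull : ∀ {A A' : (BiKummerSetting.mkOfConnectedTemperoidYddTower X tf hZ hP NH 𝒯 ιX).C} (φ : A' ⟶ A)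
    (f : (BiKummerSetting.mkOfConnectedTemperoidYddTower X tf hZ hP NH 𝒯 ιX).biratUnits A),
      ψ A' (pullFrac φ f) = pullFrac (h44.Ψ.functor.map φ) (ψ A f))
  (hii : BiKummerSetting.Thm44_ii h44 ψ) (h3 : h44.PreservesFrobeniusStructure) (h4b : h44.PreservesBaseFrobeniusTypeData)
  (h8 : h44.PreservesAmple) (h15a : h44.PreservesFixedByHA ψ) (h15 : h44.PreservesSaturated ψ)
  (hpull₂ : ∀ {X' Y Z : (BiKummerSetting.mkOfConnectedTemperoidYddTower X tf hZ hP NH 𝒯 ιX).C} (φ : X' ⟶ Y) (χ : Y ⟶ Z)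
    (g : (BiKummerSetting.mkOfConnectedTemperoidYddTower X tf hZ hP NH 𝒯 ιX).biratUnits Z),
      pullFrac (φ ≫ χ) g = pullFrac φ (pullFrac χ g))
  -- (B1)/(B1′): the Def. 4.1 (iv) datum of each transition `α_{1,N}` and its pull-back compatibility
  (D : ∀ N : ℕ+, (BiKummerSetting.mkOfConnectedTemperoidYddTower X tf hZ hP NH 𝒯 ιX).BaseFrobeniusTypeData (α (one_dvd_level N)))
  (hD : ∀ N : ℕ+, pullFrac (D N).α₁ (R 1).root = pullFrac (R N).αData.α₁ Rl.root)

/-- `deg_Fr(α_{1,N}) = N` from the tower's degree law `deg_Fr(α_{N,N'})·N = N'` at `(1, N)`.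
[cite: MochizukiEtTh2009, Rmk 4.3.2 p.318–319 (PDF pp.92–93)] -/
private theorem degFr_eq_of_one {d N : ℕ+} (hd : (d : ℕ) * ((1 : ℕ+) : ℕ) = N) : d = N := by
  rw [PNat.one_coe, mul_one] at hd
  exact PNat.coe_inj.mp hd

include comm_sCap comm_sCup isIsometry_α degFr_α isIsometry_β degFr_β hpull hii h3 h4b h8 h15a h15 hpull₂ hD in
/-- **The coherent family at the genuine setting, root-data form**: for every NORMALISED ANCHOR `(α₁, β₁, u₁)` at the first root
`R 1` (`u₁ ∈ O^×(B_1)`, `α₁⁻¹ ≫ Ψ(s^⊓_1) ≫ β₁ = s^⊓_1`, `α₁⁻¹ ≫ Ψ(s^⊔_1) ≫ β₁ = s^⊔_1 ≫ u₁`) and every level `N`: identifications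
`a : Ψ(A_N) ⥲ A_N`, `b : Ψ(B_N) ⥲ B_N` and a unit `w ∈ O^×(B_N)` with `a⁻¹ ≫ Ψ(s^⊓_N) ≫ b = s^⊓_N`, `a⁻¹ ≫ Ψ(s^⊔_N) ≫ b = s^⊔_N ≫ w`,
`a⁻¹ ≫ Ψ(α_{1,N}) ≫ α₁ = α_{1,N}`, `b⁻¹ ≫ Ψ(β_{1,N}) ≫ β₁ = β_{1,N}` — abc-iut-f-121's `NthRoot.exists_coherent_family_member_rebase`
(Prop. 4.2 (iv) at the `u₁`-twisted level-1 pair, applied to the level-`N` root rebased over the level-1 pair) with the tower's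
squares, isometries and degrees, `hdisj`/`hdisjN` (`Φ` divisorial), `hfrac := rfl` and "isomorphisms are isometries"
([FrdI] Rem. 1.1.1 at the model) discharged.
[cite: MochizukiEtTh2009, Thm 5.7 p.330 (PDF p.104); Rmk 4.3.2 p.318–319 (PDF pp.92–93); Prop 4.2 (iv) p.315 (PDF p.89)] -/
theorem hfam_of_rebase
    -- per anchor: Thm. 4.4 (ii) birational compatibility of the anchor at `A_1` with the twisted fraction
    (hf : ∀ (α₁ : h44.Ψ.functor.obj (R 1).AN ≅ (R 1).AN) (β₁ : h44.Ψ.functor.obj (R 1).BN ≅ (R 1).BN) (u₁ : Aut (R 1).BN)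
      (hu₁ : u₁ ∈ (BiKummerSetting.mkOfConnectedTemperoidYddTower X tf hZ hP NH 𝒯 ιX).units (R 1).BN),
      α₁.inv ≫ h44.Ψ.functor.map (R 1).pair.num ≫ β₁.hom = (R 1).pair.num →
      α₁.inv ≫ h44.Ψ.functor.map (R 1).pair.den ≫ β₁.hom = (R 1).pair.den ≫ u₁.hom →
        pullFrac α₁.hom
          ((BiKummerSetting.mkOfConnectedTemperoidYddTower X tf hZ hP NH 𝒯 ιX).fracOf (R 1).pair.num ((R 1).pair.den ≫ u₁.hom)
            (R 1).pair.isPreStep_num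
            ((BiKummerSetting.mkOfConnectedTemperoidYddTower X tf hZ hP NH 𝒯 ιX).isPreStep_comp_aut (R 1).pair.isPreStep_den u₁)
            ((BiKummerSetting.mkOfConnectedTemperoidYddTower X tf hZ hP NH 𝒯 ιX).baseEquivalent_comp_unit (R 1).pair.base_eq hu₁)) =
          ψ (R 1).AN (R 1).root)
    -- per anchor and level: clause (e) pointwise at the anchor, and the base isomorphism of `Ψ` at `A_N` over `α_{1,N}`
    (hArises : ∀ (α₁ : h44.Ψ.functor.obj (R 1).AN ≅ (R 1).AN) (N : ℕ+),
      (BiKummerSetting.mkOfConnectedTemperoidYddTower X tf hZ hP NH 𝒯 ιX).ArisesFromBaseFrobeniusPair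
        ((D N).G.map (h44.Ψ.functor.mapAut (R N).AN)) (h44.Ψ.functor.map (D N).α₂) (h44.Ψ.functor.map (D N).α₁ ≫ α₁.hom))
    (hebs : ∀ (α₁ : h44.Ψ.functor.obj (R 1).AN ≅ (R 1).AN) (N : ℕ+),
      ∃ ebs : (BiKummerSetting.mkOfConnectedTemperoidYddTower X tf hZ hP NH 𝒯 ιX).base.obj (R N).AN ≅
          (BiKummerSetting.mkOfConnectedTemperoidYddTower X tf hZ hP NH 𝒯 ιX).base.obj (h44.Ψ.functor.obj (R N).AN),
        (BiKummerSetting.mkOfConnectedTemperoidYddTower X tf hZ hP NH 𝒯 ιX).base.map (α (one_dvd_level N)) =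
          ebs.hom ≫ (BiKummerSetting.mkOfConnectedTemperoidYddTower X tf hZ hP NH 𝒯 ιX).base.map
            (h44.Ψ.functor.map (α (one_dvd_level N)) ≫ α₁.hom))
    -- per unit `u₁` and level: abc-iut-L2-d4's `hroot₁N` with its birational clauses (Lem. 5.8 / Def. 4.1 (iii))
    (hroot : ∀ (u₁ : Aut (R 1).BN) (hu₁ : u₁ ∈ (BiKummerSetting.mkOfConnectedTemperoidYddTower X tf hZ hP NH 𝒯 ιX).units (R 1).BN)
      (N : ℕ+), ∃ (ut : Aut (R N).BN) (hut : ut ∈ (BiKummerSetting.mkOfConnectedTemperoidYddTower X tf hZ hP NH 𝒯 ιX).units (R N).BN),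
        ut.hom ≫ β (one_dvd_level N) = β (one_dvd_level N) ≫ u₁.hom ∧
        (BiKummerSetting.mkOfConnectedTemperoidYddTower X tf hZ hP NH 𝒯 ιX).fracOf (R N).pair.num ((R N).pair.den ≫ ut.hom)
            (R N).pair.isPreStep_num
            ((BiKummerSetting.mkOfConnectedTemperoidYddTower X tf hZ hP NH 𝒯 ιX).isPreStep_comp_aut (R N).pair.isPreStep_den ut)
            ((BiKummerSetting.mkOfConnectedTemperoidYddTower X tf hZ hP NH 𝒯 ιX).baseEquivalent_comp_unit (R N).pair.base_eq hut) ^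
            (N : ℕ) =
          pullFrac (D N).α₁
            ((BiKummerSetting.mkOfConnectedTemperoidYddTower X tf hZ hP NH 𝒯 ιX).fracOf (R 1).pair.num ((R 1).pair.den ≫ u₁.hom)
              (R 1).pair.isPreStep_num
              ((BiKummerSetting.mkOfConnectedTemperoidYddTower X tf hZ hP NH 𝒯 ιX).isPreStep_comp_aut (R 1).pair.isPreStep_den u₁)
              ((BiKummerSetting.mkOfConnectedTemperoidYddTower X tf hZ hP NH 𝒯 ιX).baseEquivalent_comp_unit (R 1).pair.base_eq
                hu₁)) ∧
        (BiKummerSetting.mkOfConnectedTemperoidYddTower X tf hZ hP NH 𝒯 ιX).IsSaturated (R N).AN N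
          (pullFrac (D N).α₁
            ((BiKummerSetting.mkOfConnectedTemperoidYddTower X tf hZ hP NH 𝒯 ιX).fracOf (R 1).pair.num ((R 1).pair.den ≫ u₁.hom)
              (R 1).pair.isPreStep_num
              ((BiKummerSetting.mkOfConnectedTemperoidYddTower X tf hZ hP NH 𝒯 ιX).isPreStep_comp_aut (R 1).pair.isPreStep_den u₁)
              ((BiKummerSetting.mkOfConnectedTemperoidYddTower X tf hZ hP NH 𝒯 ιX).baseEquivalent_comp_unit (R 1).pair.base_eq
                hu₁))))
    -- Prop. 4.2 (iv) at the `u₁`-twisted level-1 pair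
    (hivP' : ∀ (u₁ : Aut (R 1).BN) (hu₁ : u₁ ∈ (BiKummerSetting.mkOfConnectedTemperoidYddTower X tf hZ hP NH 𝒯 ιX).units (R 1).BN)
      (N : ℕ+)
      (R' R'' : (BiKummerSetting.mkOfConnectedTemperoidYddTower X tf hZ hP NH 𝒯 ιX).NthRoot
        ((BiKummerSetting.mkOfConnectedTemperoidYddTower X tf hZ hP NH 𝒯 ιX).fracOf (R 1).pair.num ((R 1).pair.den ≫ u₁.hom)
          (R 1).pair.isPreStep_num
          ((BiKummerSetting.mkOfConnectedTemperoidYddTower X tf hZ hP NH 𝒯 ιX).isPreStep_comp_aut (R 1).pair.isPreStep_den u₁)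
          ((BiKummerSetting.mkOfConnectedTemperoidYddTower X tf hZ hP NH 𝒯 ιX).baseEquivalent_comp_unit (R 1).pair.base_eq hu₁))
        ((R 1).pair.twistUnit u₁ hu₁ rfl
          (BiKummerSetting.disjointSupports_twistUnit h.isDivisorial (R 1).pair u₁)) N pullFrac)
      (ebs : (BiKummerSetting.mkOfConnectedTemperoidYddTower X tf hZ hP NH 𝒯 ιX).base.obj R'.AN ≅
        (BiKummerSetting.mkOfConnectedTemperoidYddTower X tf hZ hP NH 𝒯 ιX).base.obj R''.AN),
      (BiKummerSetting.mkOfConnectedTemperoidYddTower X tf hZ hP NH 𝒯 ιX).base.map R'.α =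
        ebs.hom ≫ (BiKummerSetting.mkOfConnectedTemperoidYddTower X tf hZ hP NH 𝒯 ιX).base.map R''.α →
        ∃ (v : (BiKummerSetting.mkOfConnectedTemperoidYddTower X tf hZ hP NH 𝒯 ιX).mu R'.BN N) (ζA : R'.AN ≅ R''.AN)
          (ζB : R'.BN ≅ R''.BN),
          ζA.hom ≫ R''.pair.num = R'.pair.num ≫ ζB.hom ∧
          ζA.hom ≫ R''.pair.den = (R'.pair.den ≫ (v : Aut R'.BN).hom) ≫ ζB.hom ∧
          ζA.hom ≫ R''.α = R'.α ∧ ζB.hom ≫ R''.β = R'.β ∧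
          (BiKummerSetting.mkOfConnectedTemperoidYddTower X tf hZ hP NH 𝒯 ιX).base.mapIso ζA = ebs) :
    ∀ (α₁ : h44.Ψ.functor.obj (R 1).AN ≅ (R 1).AN) (β₁ : h44.Ψ.functor.obj (R 1).BN ≅ (R 1).BN) (u₁ : Aut (R 1).BN),
      u₁ ∈ (BiKummerSetting.mkOfConnectedTemperoidYddTower X tf hZ hP NH 𝒯 ιX).units (R 1).BN →
      α₁.inv ≫ h44.Ψ.functor.map (R 1).pair.num ≫ β₁.hom = (R 1).pair.num →
      α₁.inv ≫ h44.Ψ.functor.map (R 1).pair.den ≫ β₁.hom = (R 1).pair.den ≫ u₁.hom →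
        ∀ N : ℕ+, ∃ (a : h44.Ψ.functor.obj (R N).AN ≅ (R N).AN) (b : h44.Ψ.functor.obj (R N).BN ≅ (R N).BN)
          (w : Aut (R N).BN),
          w ∈ (BiKummerSetting.mkOfConnectedTemperoidYddTower X tf hZ hP NH 𝒯 ιX).units (R N).BN ∧
          a.inv ≫ h44.Ψ.functor.map (R N).pair.num ≫ b.hom = (R N).pair.num ∧
          a.inv ≫ h44.Ψ.functor.map (R N).pair.den ≫ b.hom = (R N).pair.den ≫ w.hom ∧
          a.inv ≫ h44.Ψ.functor.map (α (one_dvd_level N)) ≫ α₁.hom = α (one_dvd_level N) ∧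
          b.inv ≫ h44.Ψ.functor.map (β (one_dvd_level N)) ≫ β₁.hom = β (one_dvd_level N) := by
  intro α₁ β₁ u₁ hu₁ hnum hden N
  have t1 : Objectwise (fun M _ => IsDivisorial M) (BiKummerSetting.mkOfConnectedTemperoidYddTower X tf hZ hP NH 𝒯 ιX).tf.divisorMonoid := h.isDivisorial
  have t3 : (BiKummerSetting.mkOfConnectedTemperoidYddTower X tf hZ hP NH 𝒯 ιX).IsIsometry (α (one_dvd_level N)) := isIsometry_α (one_dvd_level N)
  have t3b : (BiKummerSetting.mkOfConnectedTemperoidYddTower X tf hZ hP NH 𝒯 ιX).IsIsometry (β (one_dvd_level N)) := isIsometry_β (one_dvd_level N)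
  have hdega : (BiKummerSetting.mkOfConnectedTemperoidYddTower X tf hZ hP NH 𝒯 ιX).degFr (α (one_dvd_level N)) = N := degFr_eq_of_one (degFr_α (one_dvd_level N))
  have hdegb : (BiKummerSetting.mkOfConnectedTemperoidYddTower X tf hZ hP NH 𝒯 ιX).degFr (β (one_dvd_level N)) = N := degFr_eq_of_one (degFr_β (one_dvd_level N))
  have hPF := ModelFrobenioid.isPreFrobenioid (DivB := tf.divBNatTrans) h.isMonoidOn h.isDivisorial h.isMonoidOn_rat
    h.isGroupLike_rat h.isGraphConnected h.isTotallyEpimorphic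
  have heA : (BiKummerSetting.mkOfConnectedTemperoidYddTower X tf hZ hP NH 𝒯 ιX).IsIsometry α₁.hom := PreFrobenioid.isIsometry_of_isIso _ hPF α₁.hom
  have heB : (BiKummerSetting.mkOfConnectedTemperoidYddTower X tf hZ hP NH 𝒯 ιX).IsIsometry β₁.hom := PreFrobenioid.isIsometry_of_isIso _ hPF β₁.hom
  obtain ⟨ut, hut, hover, hpow, hsat⟩ := hroot u₁ hu₁ N
  obtain ⟨ebs, hebsN⟩ := hebs α₁ N
  -- abc-iut-f-121's Prop. 4.2 (iv) at the rebased root, fed in stages (elaboration budget)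
  have stage1 := BiKummerSetting.NthRoot.exists_coherent_family_member_rebase h44 ψ pullFrac hpull hii h3 h4b h8 h15a h15
    (R N) (R 1) (α (one_dvd_level N)) (β (one_dvd_level N)) (comm_sCap (one_dvd_level N)) (comm_sCup (one_dvd_level N))
    t3 t3b hdega hdegb (D N) (hD N) u₁ hu₁ rfl (BiKummerSetting.disjointSupports_twistUnit t1 (R 1).pair u₁) α₁ β₁ hnum hden
  have stage2 := stage1 (hf α₁ β₁ u₁ hu₁ hnum hden) heA heB (hArises α₁ N) hpull₂ ut hut hover rfl
    (BiKummerSetting.disjointSupports_twistUnit t1 (R N).pair ut) hpow hsat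
  exact stage2 (hivP' u₁ hu₁ N) ebs hebsN

include comm_sCap comm_sCup isIsometry_α degFr_α isIsometry_β degFr_β hpull hii h3 h4b h8 h15a h15 hpull₂ hD in
/-- **FILE 2 of the Thm. 5.7 final knit: the coherent family `hfam` of abc-iut-L2-d4's anchored capstone, PRODUCED at the genuine
connected tower** `T = ofConnectedTemperoidFamily …` — the statement is EXACTLY the binder `hfam` of
`thetaRootPreservedAll_ofConnectedTemperoidYddFamily_ofAnchored_ofPulledConstants` (p442166) for `Ψ := h44.Ψ` (the tower bound by
`hT`, instantiate with `rfl`): `hfam_of_rebase` read through the definitional identities `T.AN N = (R N).AN`, `T.sCap N = s^⊓_N`,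
`T.sCup N = s^⊔_N`, `T.α = α_{·,·}`, `T.β = β_{·,·}`, `(T.atLevel N).units = O^×`.
[cite: MochizukiEtTh2009, Thm 5.7 p.330 (PDF p.104); Rmk 4.3.2 p.318–319 (PDF pp.92–93); Prop 4.2 (iv) p.315 (PDF p.89)] -/
theorem hfam_ofConnectedTemperoidFamily_of_rebase
    (T : ThetaFrobenioidTower.{w} (BiKummerSetting.mkOfConnectedTemperoidYddTower X tf hZ hP NH 𝒯 ιX).C
      (ConnectedPart (BTemp X.Pi)))
    (hT : T = ofConnectedTemperoidFamily h Q odd_l R ιX K' (fun N => (Units.map (tf.ratFnFunctor.map (t N).op).hom).comp c₀)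
      hinj hinvc hinvp α β comm_sCap comm_sCup isIsometry_α degFr_α isIsometry_β degFr_β baseFrob_α)
    -- per anchor: Thm. 4.4 (ii) birational compatibility of the anchor at `A_1` with the twisted fraction
    (hf : ∀ (α₁ : h44.Ψ.functor.obj (R 1).AN ≅ (R 1).AN) (β₁ : h44.Ψ.functor.obj (R 1).BN ≅ (R 1).BN) (u₁ : Aut (R 1).BN)
      (hu₁ : u₁ ∈ (BiKummerSetting.mkOfConnectedTemperoidYddTower X tf hZ hP NH 𝒯 ιX).units (R 1).BN),
      α₁.inv ≫ h44.Ψ.functor.map (R 1).pair.num ≫ β₁.hom = (R 1).pair.num →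
      α₁.inv ≫ h44.Ψ.functor.map (R 1).pair.den ≫ β₁.hom = (R 1).pair.den ≫ u₁.hom →
        pullFrac α₁.hom
          ((BiKummerSetting.mkOfConnectedTemperoidYddTower X tf hZ hP NH 𝒯 ιX).fracOf (R 1).pair.num ((R 1).pair.den ≫ u₁.hom)
            (R 1).pair.isPreStep_num
            ((BiKummerSetting.mkOfConnectedTemperoidYddTower X tf hZ hP NH 𝒯 ιX).isPreStep_comp_aut (R 1).pair.isPreStep_den u₁)
            ((BiKummerSetting.mkOfConnectedTemperoidYddTower X tf hZ hP NH 𝒯 ιX).baseEquivalent_comp_unit (R 1).pair.base_eq hu₁)) =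
          ψ (R 1).AN (R 1).root)
    -- per anchor and level: clause (e) pointwise at the anchor, and the base isomorphism of `Ψ` at `A_N` over `α_{1,N}`
    (hArises : ∀ (α₁ : h44.Ψ.functor.obj (R 1).AN ≅ (R 1).AN) (N : ℕ+),
      (BiKummerSetting.mkOfConnectedTemperoidYddTower X tf hZ hP NH 𝒯 ιX).ArisesFromBaseFrobeniusPair
        ((D N).G.map (h44.Ψ.functor.mapAut (R N).AN)) (h44.Ψ.functor.map (D N).α₂) (h44.Ψ.functor.map (D N).α₁ ≫ α₁.hom))
    (hebs : ∀ (α₁ : h44.Ψ.functor.obj (R 1).AN ≅ (R 1).AN) (N : ℕ+),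
      ∃ ebs : (BiKummerSetting.mkOfConnectedTemperoidYddTower X tf hZ hP NH 𝒯 ιX).base.obj (R N).AN ≅
          (BiKummerSetting.mkOfConnectedTemperoidYddTower X tf hZ hP NH 𝒯 ιX).base.obj (h44.Ψ.functor.obj (R N).AN),
        (BiKummerSetting.mkOfConnectedTemperoidYddTower X tf hZ hP NH 𝒯 ιX).base.map (α (one_dvd_level N)) =
          ebs.hom ≫ (BiKummerSetting.mkOfConnectedTemperoidYddTower X tf hZ hP NH 𝒯 ιX).base.map
            (h44.Ψ.functor.map (α (one_dvd_level N)) ≫ α₁.hom))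
    -- per unit `u₁` and level: abc-iut-L2-d4's `hroot₁N` with its birational clauses (Lem. 5.8 / Def. 4.1 (iii))
    (hroot : ∀ (u₁ : Aut (R 1).BN) (hu₁ : u₁ ∈ (BiKummerSetting.mkOfConnectedTemperoidYddTower X tf hZ hP NH 𝒯 ιX).units (R 1).BN)
      (N : ℕ+), ∃ (ut : Aut (R N).BN) (hut : ut ∈ (BiKummerSetting.mkOfConnectedTemperoidYddTower X tf hZ hP NH 𝒯 ιX).units (R N).BN),
        ut.hom ≫ β (one_dvd_level N) = β (one_dvd_level N) ≫ u₁.hom ∧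
        (BiKummerSetting.mkOfConnectedTemperoidYddTower X tf hZ hP NH 𝒯 ιX).fracOf (R N).pair.num ((R N).pair.den ≫ ut.hom)
            (R N).pair.isPreStep_num
            ((BiKummerSetting.mkOfConnectedTemperoidYddTower X tf hZ hP NH 𝒯 ιX).isPreStep_comp_aut (R N).pair.isPreStep_den ut)
            ((BiKummerSetting.mkOfConnectedTemperoidYddTower X tf hZ hP NH 𝒯 ιX).baseEquivalent_comp_unit (R N).pair.base_eq hut) ^
            (N : ℕ) =
          pullFrac (D N).α₁
            ((BiKummerSetting.mkOfConnectedTemperoidYddTower X tf hZ hP NH 𝒯 ιX).fracOf (R 1).pair.num ((R 1).pair.den ≫ u₁.hom)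
              (R 1).pair.isPreStep_num
              ((BiKummerSetting.mkOfConnectedTemperoidYddTower X tf hZ hP NH 𝒯 ιX).isPreStep_comp_aut (R 1).pair.isPreStep_den u₁)
              ((BiKummerSetting.mkOfConnectedTemperoidYddTower X tf hZ hP NH 𝒯 ιX).baseEquivalent_comp_unit (R 1).pair.base_eq
                hu₁)) ∧
        (BiKummerSetting.mkOfConnectedTemperoidYddTower X tf hZ hP NH 𝒯 ιX).IsSaturated (R N).AN N
          (pullFrac (D N).α₁
            ((BiKummerSetting.mkOfConnectedTemperoidYddTower X tf hZ hP NH 𝒯 ιX).fracOf (R 1).pair.num ((R 1).pair.den ≫ u₁.hom)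
              (R 1).pair.isPreStep_num
              ((BiKummerSetting.mkOfConnectedTemperoidYddTower X tf hZ hP NH 𝒯 ιX).isPreStep_comp_aut (R 1).pair.isPreStep_den u₁)
              ((BiKummerSetting.mkOfConnectedTemperoidYddTower X tf hZ hP NH 𝒯 ιX).baseEquivalent_comp_unit (R 1).pair.base_eq
                hu₁))))
    -- Prop. 4.2 (iv) at the `u₁`-twisted level-1 pair
    (hivP' : ∀ (u₁ : Aut (R 1).BN) (hu₁ : u₁ ∈ (BiKummerSetting.mkOfConnectedTemperoidYddTower X tf hZ hP NH 𝒯 ιX).units (R 1).BN)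
      (N : ℕ+)
      (R' R'' : (BiKummerSetting.mkOfConnectedTemperoidYddTower X tf hZ hP NH 𝒯 ιX).NthRoot
        ((BiKummerSetting.mkOfConnectedTemperoidYddTower X tf hZ hP NH 𝒯 ιX).fracOf (R 1).pair.num ((R 1).pair.den ≫ u₁.hom)
          (R 1).pair.isPreStep_num
          ((BiKummerSetting.mkOfConnectedTemperoidYddTower X tf hZ hP NH 𝒯 ιX).isPreStep_comp_aut (R 1).pair.isPreStep_den u₁)
          ((BiKummerSetting.mkOfConnectedTemperoidYddTower X tf hZ hP NH 𝒯 ιX).baseEquivalent_comp_unit (R 1).pair.base_eq hu₁))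
        ((R 1).pair.twistUnit u₁ hu₁ rfl
          (BiKummerSetting.disjointSupports_twistUnit h.isDivisorial (R 1).pair u₁)) N pullFrac)
      (ebs : (BiKummerSetting.mkOfConnectedTemperoidYddTower X tf hZ hP NH 𝒯 ιX).base.obj R'.AN ≅
        (BiKummerSetting.mkOfConnectedTemperoidYddTower X tf hZ hP NH 𝒯 ιX).base.obj R''.AN),
      (BiKummerSetting.mkOfConnectedTemperoidYddTower X tf hZ hP NH 𝒯 ιX).base.map R'.α =
        ebs.hom ≫ (BiKummerSetting.mkOfConnectedTemperoidYddTower X tf hZ hP NH 𝒯 ιX).base.map R''.α →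
        ∃ (v : (BiKummerSetting.mkOfConnectedTemperoidYddTower X tf hZ hP NH 𝒯 ιX).mu R'.BN N) (ζA : R'.AN ≅ R''.AN)
          (ζB : R'.BN ≅ R''.BN),
          ζA.hom ≫ R''.pair.num = R'.pair.num ≫ ζB.hom ∧
          ζA.hom ≫ R''.pair.den = (R'.pair.den ≫ (v : Aut R'.BN).hom) ≫ ζB.hom ∧
          ζA.hom ≫ R''.α = R'.α ∧ ζB.hom ≫ R''.β = R'.β ∧
          (BiKummerSetting.mkOfConnectedTemperoidYddTower X tf hZ hP NH 𝒯 ιX).base.mapIso ζA = ebs) :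
    ∀ (α₁ : h44.Ψ.functor.obj (T.AN 1) ≅ T.AN 1) (β₁ : h44.Ψ.functor.obj (T.BN 1) ≅ T.BN 1) (u₁ : Aut (T.BN 1)),
      u₁ ∈ (T.atLevel 1).units (T.BN 1) →
      α₁.inv ≫ h44.Ψ.functor.map (T.sCap 1) ≫ β₁.hom = T.sCap 1 →
      α₁.inv ≫ h44.Ψ.functor.map (T.sCup 1) ≫ β₁.hom = T.sCup 1 ≫ u₁.hom →
        ∀ N : ℕ+, ∃ (a : h44.Ψ.functor.obj (T.AN N) ≅ T.AN N) (b : h44.Ψ.functor.obj (T.BN N) ≅ T.BN N) (w : Aut (T.BN N)),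
          w ∈ (T.atLevel N).units (T.BN N) ∧
          a.inv ≫ h44.Ψ.functor.map (T.sCap N) ≫ b.hom = T.sCap N ∧
          a.inv ≫ h44.Ψ.functor.map (T.sCup N) ≫ b.hom = T.sCup N ≫ w.hom ∧
          a.inv ≫ h44.Ψ.functor.map (T.α (one_dvd_level N)) ≫ α₁.hom = T.α (one_dvd_level N) ∧
          b.inv ≫ h44.Ψ.functor.map (T.β (one_dvd_level N)) ≫ β₁.hom = T.β (one_dvd_level N) := by
  subst hT
  intro α₁ β₁ u₁ hu₁ hnum hden N
  exact hfam_of_rebase 𝒯 ιX h R α β comm_sCap comm_sCup isIsometry_α degFr_α isIsometry_β degFr_β h44 ψ hpull hii h3 h4b h8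
    h15a h15 hpull₂ D hD hf hArises hebs hroot hivP' α₁ β₁ u₁ hu₁ hnum hden N

end ThetaFrobenioidTower

end Literature.AnabelianGeometry.EtaleTheta

end
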